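import Summits.NavierStokesRegularity.NavierStokesRegularity.Theses.RotatedEulerWindow
import Summits.NavierStokesRegularity.NavierStokesRegularity.Theorems.TypeIliouvilleNoTypeII.Negative.WithoutLerayHopfFalse

/-!
# `RotatedWindowCore` (stmt-NavierStokesRegularity-19281): the Leray–Hopf hypothesis is load-bearing

Negative (support) lemma for the crux `RotatedEulerWindow.RotatedWindowCore` (route
`RotatedEulerWindow`, rank 3), refuter crux-attack at birth (2026-08-17). Theorems only (no definitions).

* `rotatedWindowCore_false_without_lerayHopf`: the crux with its hypothesis `IsLerayHopfOn T ν 0 (u 0) u`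
  deleted — and nothing else changed — is FALSE. Witness (`ν = T = 1`): the Type-II member
  `g(t) = (1 − t)⁻¹ − 1` of the parasitic drift family `u = g(t)·e₀`, `p = −g′(t) x₀` of
  Koch–Nadirashvili–Seregin–Šverák (Acta Math. 203 (2009), §1), i.e. the in-tree
  `drift_gII_isMaximalSmoothSolution` / `drift_rapidDecay` / `drift_gII_not_isTypeIBlowup`
  (`Theorems/TypeIliouvilleNoTypeII/Negative/WithoutLerayHopfFalse.lean`): a maximal smooth solution on
  `[0, 1)` from the datum `0`, not Type I, whose vorticity vanishes identically (every slice is a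
  constant field: `Literature.Analysis.FluidPDE.curl_eq_zero_of_fderiv_eq_zero`) — so no zoom with core
  amplitudes `A_k = ‖curl u(t_k)(x_k)‖ > 0` exists, whatever the profile part.

Information for provers: every proof of the crux must use the energy class (`IsLerayHopfOn`) already to
produce a single point of non-zero vorticity near the blow-up time; the other three hypotheses
(`IsMaximalSmoothSolution`, `HasRapidSpatialDecay (u 0)`, `¬ IsTypeIBlowup`) are jointly satisfiable by
an irrotational non-Type-I maximal solution.
[cite: KochNadirashviliSereginSverak2009, §1 p. 3 (parasitic solutions)]
-/

noncomputable section

-- single-conjunct summit: `<Summit>.<Problem>` repeats the name (tree-wide convention, lakefile weak option)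
set_option linter.dupNamespace false

namespace Summit.NavierStokesRegularity.NavierStokesRegularity.Theorems.RotatedWindowCoreNegative

open Set Filter Topology Function
open Literature.Analysis.FluidPDE
open Summit.NavierStokesRegularity.NavierStokesRegularity.Theorems.RungReynoldsOneNegative
open Summit.NavierStokesRegularity.NavierStokesRegularity.Theorems.TypeIliouvilleNoTypeIINegative

/-- **Finite energy is load-bearing for `RotatedWindowCore`.** The crux
`RotatedEulerWindow.RotatedWindowCore` (item stmt-NavierStokesRegularity-19281) with its hypothesis
`IsLerayHopfOn T ν 0 (u 0) u` deleted — verbatim otherwise — is FALSE: at `ν = T = 1` the Type-II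
parasitic drift `u = g(t)·e₀`, `g(t) = (1 − t)⁻¹ − 1`, `p = −g′(t) x₀` is a maximal smooth solution from
the rapidly decaying datum `0`, not of Type I, and irrotational, so the zoom clause
`‖curl (u (t k)) (x k)‖ = A k` with `0 < A k` fails at `k = 0` for every candidate zoom
(Koch–Nadirashvili–Seregin–Šverák 2009, §1 p. 3: parasitic solutions `u = b(t)`, `p = −b′(t)·x`).
[cite: KochNadirashviliSereginSverak2009, §1 p. 3 (parasitic solutions)] -/
theorem rotatedWindowCore_false_without_lerayHopf :
    ¬ (∀ (ν T : ℝ), 0 < ν → 0 < T → ∀ (u : ℝ → EuclideanSpace ℝ (Fin 3) → EuclideanSpace ℝ (Fin 3)) (p : ℝ → EuclideanSpace ℝ (Fin 3) → ℝ), Literature.Analysis.FluidPDE.IsMaximalSmoothSolution ν 0 u p T → Literature.Analysis.FluidPDE.HasRapidSpatialDecay (u 0) → ¬ Literature.Analysis.FluidPDE.IsTypeIBlowup u T → ∃ (β α : ℝ) (e : EuclideanSpace ℝ (Fin 3)) (U Ω : EuclideanSpace ℝ (Fin 3) → EuclideanSpace ℝ (Fin 3)), ‖e‖ = 1 ∧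 ((2 / 5 : ℝ) ≤ β ∧ β < 1 / 2 ∧ ContDiff ℝ 2 U ∧ ContDiff ℝ 1 Ω ∧ Literature.Analysis.FluidPDE.VectorCalculus.IsDivFree U ∧ (∃ m : ℝ, 0 < m ∧ ∀ y, m • Ω y = Literature.Analysis.FluidPDE.curl U y) ∧ (∃ L : NNReal, LipschitzWith L U ∧ LipschitzWith L Ω) ∧ (∃ (c : EuclideanSpace ℝ (Fin 3)) (P : EuclideanSpace ℝ (Fin 3) → ℝ), ContDiff ℝ 1 P ∧ (∀ y, (1 - β) • U y + α • Literature.Analysis.FluidPDE.cross e (U y) + fderiv ℝ U y (β • (y - c) - α • Literature.Analysis.FluidPDE.cross e (y - c) + U y) + gradient P y = 0) ∧ (∀ y, fderiv ℝ Ω y (β • (y - c) - α • Literature.Analysis.FluidPDE.cross e (y - c) + U y) - fderiv ℝ U y (Ω y) = -(Ω y) - α • Literature.Analysis.FluidPDE.cross e (Ω y))) ∧ (∃ C : ℝ, ∀ y, ‖Ω y‖ ≤ C * (1 + ‖y‖) ^ (-(1 / β)) ∧ ‖U y‖ ≤ C * (1 + ‖y‖) ^ (1 - 1 / β)) ∧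 ‖Ω 0‖ = 1) ∧ ∃ (t : ℕ → ℝ) (x : ℕ → EuclideanSpace ℝ (Fin 3)) (A ℓ : ℕ → ℝ) (Q : ℕ → (EuclideanSpace ℝ (Fin 3) ≃ₗᵢ[ℝ] EuclideanSpace ℝ (Fin 3))), (∀ k, 0 ≤ t k ∧ t k < T) ∧ Filter.Tendsto t Filter.atTop (nhds T) ∧ (∀ k, 0 < A k ∧ 0 < ℓ k) ∧ Filter.Tendsto A Filter.atTop Filter.atTop ∧ Filter.Tendsto ℓ Filter.atTop (nhds 0) ∧ (∀ k, ‖Literature.Analysis.FluidPDE.curl (u (t k)) (x k)‖ = A k) ∧ (∀ k, (∀ z, dist z (x k) < ℓ k → A k / 2 < ‖Literature.Analysis.FluidPDE.curl (u (t k)) z‖) ∧ ∃ z, dist z (x k) = ℓ k ∧ ‖Literature.Analysis.FluidPDE.curl (u (t k)) z‖ ≤ A k / 2) ∧ Filter.Tendsto (fun k => A k * ℓ k ^ 2 / ν) Filter.atTop Filter.atTop ∧ ∀ R ε : ℝ, 0 < R → 0 < ε → ∃ k₀ : ℕ, ∀ k ≥ k₀, ∀ y : EuclideanSpace ℝ (Fin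 3), ‖y‖ ≤ R → ‖(A k)⁻¹ • (Q k).symm (Literature.Analysis.FluidPDE.curl (u (t k)) (x k + ℓ k • Q k y)) - Ω y‖ + ‖fderiv ℝ (fun y' => (A k)⁻¹ • (Q k).symm (Literature.Analysis.FluidPDE.curl (u (t k)) (x k + ℓ k • Q k y'))) y - fderiv ℝ Ω y‖ ≤ ε) := by
  intro h
  obtain ⟨β, α, e, U, Ω, -, -, t, x, A, ℓ, Q, -, -, hAℓ, -, -, hA, -⟩ :=
    h 1 1 one_pos one_pos _ _ (drift_gII_isMaximalSmoothSolution 1) (drift_rapidDecay gII_zero)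
      drift_gII_not_isTypeIBlowup
  have h0 := hA 0
  rw [drift_apply, curl_eq_zero_of_fderiv_eq_zero (fderiv_const_apply _), norm_zero] at h0
  exact (hAℓ 0).1.ne h0

end Summit.NavierStokesRegularity.NavierStokesRegularity.Theorems.RotatedWindowCoreNegative

end
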